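import Mathlib
import Summits.MatrixMultiplication.MatrixMultiplication.Theorems.SnSubsetDichotomyPolynomialSlackPrintRegime
import Summits.MatrixMultiplication.MatrixMultiplication.Theorems.SnSubsetDichotomyPolynomialSlackLopsidedNearWall

/-!
# Balanced TPP triples in `S_n` have polynomial slack up to exponent `3/4` (conditional)

Crux `Summit.MatrixMultiplication.MatrixMultiplication.Theses.SnSubsetDichotomy.PolynomialSlack`
(item `stmt-MatrixMultiplication-8306`), level-one programme, step B (assembly). From the explicit
near-wall inequality `lopsidedNearWall` (parity-pure triples) we derive

* `nearWall` — the same inequality for ARBITRARY TPP triples `S, T, U ⊆ S_n`, `n ≥ 40`, at the cost of a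
  factor `8` (pass to the majority sign class of each set; `x ↦ x·log(4n·n!/x)` is increasing on `x ≤ n!`):
  `|S||T||U|/4 ≤ n! + n!√(n!)/√(n(n-1)/6) + 20·n!/√n · Σ_{pairs} √(|X||Y|·(1 + log n)·log(4n·n!/(|X||Y|)))`;
* `balanced_slack_of_lt_threeQuarters` — for every `C < 3/4` there is `n₀` such that every TPP triple
  with `|S| = |T| = |U|` in `S_n`, `n ≥ n₀`, satisfies `|S||T||U|·n^C ≤ (n!)^{3/2}` — the crux inequality
  for balanced triples, beyond the printed exponent `1/2` (`polynomialSlack_of_lt_half`, used here for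
  `C < 1/2`).

Both are UNCONDITIONAL: the Bernstein inequality for permuted sums they rest on is the tree's own
`card_permutedSum_tail_le` (via `deficit_budget'`, `lopsidedNearWall`); the logarithms carry the factor
`1 + log n` coming from its variance proxy.
-/

namespace Summit.MatrixMultiplication.MatrixMultiplication.Theorems.PolynomialSlack

open scoped BigOperators
open Literature.Combinatorics.Additive (TripleProductProperty)

-- `Summit.<Summit>.<Problem>` is the tree's mandated summit-side namespace (CONVENTIONS §2); for
-- this single-conjunct summit the two coincide, so each declaration silences `dupNamespace`.
set_option linter.dupNamespace false

/-- Monotonicity of `x ↦ x·log(c/x)` on `(0, c/e]`: for `0 < x ≤ y` with `y·e ≤ c`,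
`x·log(c/x) ≤ y·log(c/y)`. [folklore] -/
theorem mul_log_div_le_mul_log_div {x y c : ℝ} (hx : 0 < x) (hxy : x ≤ y) (hyc : y * Real.exp 1 ≤ c) :
    x * Real.log (c / x) ≤ y * Real.log (c / y) := by
  have hy : 0 < y := hx.trans_le hxy
  have hc : 0 < c := lt_of_lt_of_le (by positivity) hyc
  rw [Real.log_div hc.ne' hx.ne', Real.log_div hc.ne' hy.ne']
  have h1 : Real.log y - Real.log x ≤ y / x - 1 := by
    rw [← Real.log_div hy.ne' hx.ne']
    exact Real.log_le_sub_one_of_pos (by positivity)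
  have h1' : x * (Real.log y - Real.log x) ≤ y - x := by
    calc x * (Real.log y - Real.log x) ≤ x * (y / x - 1) := mul_le_mul_of_nonneg_left h1 hx.le
      _ = y - x := by field_simp
  have h2 : Real.log y + 1 ≤ Real.log c := by
    have := Real.log_le_log (by positivity) hyc
    rwa [Real.log_mul hy.ne' (Real.exp_pos 1).ne', Real.log_exp] at this
  nlinarith [mul_le_mul_of_nonneg_left h2 (sub_nonneg.mpr hxy), h1']

/-- **Majority sign class.** Every `S ⊆ S_n` contains a subset `S'` of constant sign with
`|S| ≤ 2|S'|`. [folklore] -/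
theorem exists_signPure_half {n : ℕ} (S : Finset (Equiv.Perm (Fin n))) :
    ∃ S' ⊆ S, (∀ s ∈ S', ∀ s' ∈ S', Equiv.Perm.sign s = Equiv.Perm.sign s') ∧ S.card ≤ 2 * S'.card := by
  have hsum := Finset.card_filter_add_card_filter_not (s := S)
    (fun s : Equiv.Perm (Fin n) => Equiv.Perm.sign s = 1)
  by_cases h : (S.filter fun s => ¬ Equiv.Perm.sign s = 1).card ≤
      (S.filter fun s => Equiv.Perm.sign s = 1).card
  · refine ⟨S.filter fun s => Equiv.Perm.sign s = 1, Finset.filter_subset _ _, ?_, ?_⟩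
    · intro s hs s' hs'
      rw [(Finset.mem_filter.mp hs).2, (Finset.mem_filter.mp hs').2]
    · omega
  · refine ⟨S.filter fun s => ¬ Equiv.Perm.sign s = 1, Finset.filter_subset _ _, ?_, ?_⟩
    · intro s hs s' hs'
      have h1 := (Finset.mem_filter.mp hs).2
      have h2 := (Finset.mem_filter.mp hs').2
      rcases Int.units_eq_one_or (Equiv.Perm.sign s) with e | e
      · exact absurd e h1
      rcases Int.units_eq_one_or (Equiv.Perm.sign s') with e' | e'
      · exact absurd e' h2
      rw [e, e']
    · omega

/-- **Near-wall inequality for arbitrary TPP triples in `S_n`** (`n ≥ 40`, unconditional): passing to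
the majority sign class of each of `S, T, U` (a TPP sub-triple of at least `1/8` the volume) and applying
`lopsidedNearWall`,
`|S||T||U|/4 ≤ n! + n!·√(n!)/√(n(n-1)/6) + (20·n!/√n)·Σ_{(X,Y)} √(|X||Y|·(1 + log n)·log(4n·n!/(|X||Y|)))`
over the pairs `(S,T), (T,U), (U,S)`; the pair terms only decrease under passing to subsets because
`x ↦ x·log(4n·n!/x)` is increasing for `x ≤ n!` (`mul_log_div_le_mul_log_div`). -/
theorem nearWall {n : ℕ}
    (hn : 40 ≤ n) (S T U : Finset (Equiv.Perm (Fin n))) (hTPP : TripleProductProperty S T U) :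
    ((S.card * T.card * U.card : ℕ) : ℝ) / 4 ≤
      (n.factorial : ℝ) + (n.factorial : ℝ) * Real.sqrt (n.factorial : ℝ) / Real.sqrt (((n * (n - 1) : ℕ) : ℝ) / 6) +
        20 * (n.factorial : ℝ) / Real.sqrt n *
          (Real.sqrt ((S.card * T.card : ℕ) * ((1 + Real.log n) * Real.log (4 * n * n.factorial / (S.card * T.card : ℕ)))) +
            Real.sqrt ((T.card * U.card : ℕ) * ((1 + Real.log n) * Real.log (4 * n * n.factorial / (T.card * U.card : ℕ)))) +
            Real.sqrt ((U.card * S.card : ℕ) * ((1 + Real.log n) * Real.log (4 * n * n.factorial / (U.card * S.card : ℕ))))) := by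
  by_cases hN0 : S.card * T.card * U.card = 0
  · rw [hN0, Nat.cast_zero, zero_div]; positivity
  have hS0 : S.card ≠ 0 := fun h => hN0 (by simp [h])
  have hT0 : T.card ≠ 0 := fun h => hN0 (by simp [h])
  have hU0 : U.card ≠ 0 := fun h => hN0 (by simp [h])
  have hSne : S.Nonempty := Finset.card_pos.mp (Nat.pos_of_ne_zero hS0)
  have hTne : T.Nonempty := Finset.card_pos.mp (Nat.pos_of_ne_zero hT0)
  have hUne : U.Nonempty := Finset.card_pos.mp (Nat.pos_of_ne_zero hU0)
  obtain ⟨S', hS'S, hS'sgn, hS'c⟩ := exists_signPure_half S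
  obtain ⟨T', hT'T, hT'sgn, hT'c⟩ := exists_signPure_half T
  obtain ⟨U', hU'U, hU'sgn, hU'c⟩ := exists_signPure_half U
  have hS'0 : S'.card ≠ 0 := by omega
  have hT'0 : T'.card ≠ 0 := by omega
  have hU'0 : U'.card ≠ 0 := by omega
  have h := lopsidedNearWall n hn S' T' U' (hTPP.mono hS'S hT'T hU'U) hS'sgn hT'sgn hU'sgn
  -- compare the volumes
  have hNN : ((S.card * T.card * U.card : ℕ) : ℝ) ≤ 8 * ((S'.card * T'.card * U'.card : ℕ) : ℝ) := by
    have : S.card * T.card * U.card ≤ 8 * (S'.card * T'.card * U'.card) := by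
      calc S.card * T.card * U.card ≤ (2 * S'.card) * (2 * T'.card) * (2 * U'.card) :=
            Nat.mul_le_mul (Nat.mul_le_mul hS'c hT'c) hU'c
        _ = 8 * (S'.card * T'.card * U'.card) := by ring
    exact_mod_cast this
  -- compare the pair terms
  have hF0 : (0 : ℝ) < n.factorial := by exact_mod_cast n.factorial_pos
  have hn1 : (1 : ℝ) ≤ n := by exact_mod_cast (show 1 ≤ n by omega)
  have key : ∀ {X Y X' Y' : Finset (Equiv.Perm (Fin n))}, X' ⊆ X → Y' ⊆ Y → X'.card ≠ 0 → Y'.card ≠ 0 →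
      Set.InjOn (fun xy : Equiv.Perm (Fin n) × Equiv.Perm (Fin n) => xy.1⁻¹ * xy.2)
        (↑X ×ˢ ↑Y : Set (Equiv.Perm (Fin n) × Equiv.Perm (Fin n))) →
      Real.sqrt ((X'.card * Y'.card : ℕ) * ((1 + Real.log n) * Real.log (4 * n * n.factorial / (X'.card * Y'.card : ℕ)))) ≤
        Real.sqrt ((X.card * Y.card : ℕ) * ((1 + Real.log n) * Real.log (4 * n * n.factorial / (X.card * Y.card : ℕ)))) := by
    intro X Y X' Y' hX hY hX0 hY0 hinj
    apply Real.sqrt_le_sqrt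
    have hx : (0 : ℝ) < (X'.card * Y'.card : ℕ) := by
      exact_mod_cast Nat.mul_pos (Nat.pos_of_ne_zero hX0) (Nat.pos_of_ne_zero hY0)
    have hxy : ((X'.card * Y'.card : ℕ) : ℝ) ≤ (X.card * Y.card : ℕ) := by
      exact_mod_cast Nat.mul_le_mul (Finset.card_le_card hX) (Finset.card_le_card hY)
    have hyF : ((X.card * Y.card : ℕ) : ℝ) ≤ n.factorial := by
      exact_mod_cast card_mul_card_le_factorial_of_injOn hinj
    have hG0 : 0 ≤ 1 + Real.log n := by linarith [Real.log_nonneg hn1]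
    have hmono : ((X'.card * Y'.card : ℕ) : ℝ) * Real.log (4 * n * n.factorial / (X'.card * Y'.card : ℕ)) ≤
        ((X.card * Y.card : ℕ) : ℝ) * Real.log (4 * n * n.factorial / (X.card * Y.card : ℕ)) := by
      refine mul_log_div_le_mul_log_div hx hxy ?_
      have he : Real.exp 1 ≤ 3 := le_of_lt (lt_trans Real.exp_one_lt_d9 (by norm_num))
      calc ((X.card * Y.card : ℕ) : ℝ) * Real.exp 1 ≤ (n.factorial : ℝ) * 3 :=
            mul_le_mul hyF he (Real.exp_pos 1).le hF0.le
        _ ≤ 4 * n * n.factorial := by nlinarith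
    calc ((X'.card * Y'.card : ℕ) : ℝ) * ((1 + Real.log n) * Real.log (4 * n * n.factorial / (X'.card * Y'.card : ℕ)))
        = (1 + Real.log n) * (((X'.card * Y'.card : ℕ) : ℝ) * Real.log (4 * n * n.factorial / (X'.card * Y'.card : ℕ))) := by ring
      _ ≤ (1 + Real.log n) * (((X.card * Y.card : ℕ) : ℝ) * Real.log (4 * n * n.factorial / (X.card * Y.card : ℕ))) :=
          mul_le_mul_of_nonneg_left hmono hG0
      _ = _ := by ring
  have hinjA := injOn_quot_first hTPP hUne
  have hinjB := injOn_quot_second hTPP hSne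
  have hinjC := injOn_quot_first hTPP.rotate.rotate hTne
  have e1 := key hS'S hT'T hS'0 hT'0 hinjA
  have e2 := key hT'T hU'U hT'0 hU'0 hinjB
  have e3 := key hU'U hS'S hU'0 hS'0 hinjC
  have h20 : (0 : ℝ) ≤ 20 * (n.factorial : ℝ) / Real.sqrt n := by positivity
  have hsum := mul_le_mul_of_nonneg_left (add_le_add (add_le_add e1 e2) e3) h20
  linarith

/-- **Balanced TPP triples have polynomial slack for every exponent `C < 3/4`** (unconditional): for
every real `C < 3/4` there is `n₀` such that for all `n ≥ n₀` and all `S, T, U ⊆ S_n` with the triple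
product property and `|S| = |T| = |U|`, `|S||T||U|·n^C ≤ (n!)^{3/2}`. For `C < 1/2` this is the printed
regime (`polynomialSlack_of_lt_half`, all triples); for `1/2 ≤ C < 3/4` it follows from `nearWall`: with
`m = |S|`, `p = n^{C/3}`, if `m·p > √(n!)` then `(1 + log n)·log(4n·n!/m²) ≤ 4 log² n` and each of the three
terms of `nearWall` is below `m³/12` once `n^{1-C} ≥ 64` and `1440·log n·n^{2C/3} ≤ √n` — both eventually
true since `C < 3/4`. -/
theorem balanced_slack_of_lt_threeQuarters (C : ℝ) (hC : C < 3 / 4) :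
    ∃ n₀ : ℕ, ∀ n ≥ n₀, ∀ S T U : Finset (Equiv.Perm (Fin n)), TripleProductProperty S T U →
      S.card = T.card → T.card = U.card →
      ((S.card * T.card * U.card : ℕ) : ℝ) * (n : ℝ) ^ C ≤ (n.factorial : ℝ) ^ ((3 : ℝ) / 2) := by
  by_cases hC2 : C < 1 / 2
  · obtain ⟨n₀, hn₀⟩ := polynomialSlack_of_lt_half C hC2
    exact ⟨n₀, fun n hn S T U hTPP _ _ => hn₀ n hn S T U hTPP⟩
  rw [not_lt] at hC2
  have h1C : 0 < 1 - C := by linarith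
  have h2e : 0 < 1 / 2 - 2 * C / 3 := by linarith
  -- the constant of the third term
  set c : ℝ := 1 / 1440 with hc
  have hc0 : 0 < c := by positivity
  -- eventual facts in a real variable
  have E1 : ∀ᶠ x : ℝ in Filter.atTop, 64 ≤ x ^ (1 - C) := (tendsto_rpow_atTop h1C).eventually_ge_atTop 64
  have E2 : ∀ᶠ x : ℝ in Filter.atTop, Real.log x ≤ c * x ^ (1 / 2 - 2 * C / 3) := by
    have := (isLittleO_log_rpow_atTop h2e).def (c := c) hc0
    filter_upwards [this, Filter.eventually_ge_atTop 1] with x hx hx1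
    rw [Real.norm_eq_abs, Real.norm_eq_abs, abs_of_nonneg (Real.log_nonneg hx1),
      abs_of_nonneg (Real.rpow_nonneg (by linarith) _)] at hx
    exact hx
  obtain ⟨x₀, hx₀⟩ := Filter.eventually_atTop.mp (E1.and (E2.and (Filter.eventually_ge_atTop 40)))
  refine ⟨⌈x₀⌉₊, fun n hn S T U hTPP hST hTU => ?_⟩
  have hnx : x₀ ≤ n := (Nat.le_ceil x₀).trans (by exact_mod_cast hn)
  obtain ⟨hE1, hE2, h40⟩ := hx₀ n hnx
  have hn40 : 40 ≤ n := by exact_mod_cast h40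
  have hn0 : (0 : ℝ) < n := by linarith only [h40]
  have hF0 : (0 : ℝ) < n.factorial := by exact_mod_cast n.factorial_pos
  -- the near-wall inequality for the balanced triple
  have hW := nearWall hn40 S T U hTPP
  rw [← hTU, ← hST] at hW ⊢
  -- the players: `m = |S|`, `f = √(n!)`, `p = n^{C/3}`, `s = √n`, `ℓ = √(log n)`
  obtain ⟨m, hm⟩ : ∃ m : ℝ, m = (S.card : ℝ) := ⟨_, rfl⟩
  obtain ⟨f, hf⟩ : ∃ f : ℝ, f = Real.sqrt (n.factorial : ℝ) := ⟨_, rfl⟩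
  obtain ⟨p, hp⟩ : ∃ p : ℝ, p = (n : ℝ) ^ (C / 3) := ⟨_, rfl⟩
  obtain ⟨s, hs⟩ : ∃ s : ℝ, s = Real.sqrt (n : ℝ) := ⟨_, rfl⟩
  obtain ⟨ℓ, hℓ⟩ : ∃ ℓ : ℝ, ℓ = Real.sqrt (Real.log n) := ⟨_, rfl⟩
  have hm0 : 0 ≤ m := by rw [hm]; positivity
  have hf0 : 0 < f := by rw [hf]; exact Real.sqrt_pos.mpr hF0
  have hp1 : 1 ≤ p := by rw [hp]; exact Real.one_le_rpow (by linarith only [h40]) (by linarith only [hC2])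
  have hp0 : 0 < p := by linarith only [hp1]
  have hs0 : 0 < s := by rw [hs]; exact Real.sqrt_pos.mpr hn0
  have hℓ0 : 0 ≤ ℓ := by rw [hℓ]; exact Real.sqrt_nonneg _
  have hlog1 : 1 ≤ Real.log n := by
    rw [← Real.log_exp 1]
    exact Real.log_le_log (Real.exp_pos 1) (le_trans (le_of_lt (lt_trans Real.exp_one_lt_d9 (by norm_num))) h40)
  have hlogℓ : Real.log n = ℓ ^ 2 := by rw [hℓ, Real.sq_sqrt (by linarith)]
  have hFf : (n.factorial : ℝ) = f ^ 2 := by rw [hf, Real.sq_sqrt hF0.le]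
  have hns : (n : ℝ) = s ^ 2 := by rw [hs, Real.sq_sqrt hn0.le]
  -- casts of the volume and the pair products
  have hN : ((S.card * S.card * S.card : ℕ) : ℝ) = m ^ 3 := by rw [hm]; push_cast; ring
  have hA : ((S.card * S.card : ℕ) : ℝ) = m ^ 2 := by rw [hm]; push_cast; ring
  rw [hN, hA] at hW
  rw [hN]
  -- `n^C = p^3`, `(n!)^{3/2} = f^3`
  have hnC : (n : ℝ) ^ C = p ^ 3 := by
    rw [hp, ← Real.rpow_natCast, ← Real.rpow_mul hn0.le]; congr 1; push_cast; ring
  have hF32 : (n.factorial : ℝ) ^ ((3 : ℝ) / 2) = f ^ 3 := by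
    rw [hf, Real.sqrt_eq_rpow, ← Real.rpow_natCast, ← Real.rpow_mul hF0.le]; congr 1; norm_num
  rw [hnC, hF32]
  -- (E1'): `64 p^3 ≤ n`
  have hE1' : 64 * p ^ 3 ≤ n := by
    have e : (n : ℝ) = (n : ℝ) ^ (1 - C) * p ^ 3 := by
      rw [← hnC, ← Real.rpow_add hn0, sub_add_cancel, Real.rpow_one]
    rw [e]; exact mul_le_mul_of_nonneg_right hE1 (by positivity)
  -- (E2'): `1440 ℓ² p² ≤ s`
  have hE2' : 1440 * ℓ ^ 2 * p ^ 2 ≤ s := by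
    have h1 : ℓ ^ 2 ≤ c * (n : ℝ) ^ (1 / 2 - 2 * C / 3) := by rw [← hlogℓ]; exact hE2
    have h2 : p ^ 2 = (n : ℝ) ^ (2 * C / 3) := by
      rw [hp, ← Real.rpow_natCast, ← Real.rpow_mul hn0.le]; congr 1; push_cast; ring
    have h3 : (n : ℝ) ^ (1 / 2 - 2 * C / 3) * (n : ℝ) ^ (2 * C / 3) = s := by
      rw [← Real.rpow_add hn0, hs, Real.sqrt_eq_rpow]; congr 1; ring
    have h4 : ℓ ^ 2 * p ^ 2 ≤ c * s := by
      rw [← h3, h2, ← mul_assoc]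
      exact mul_le_mul_of_nonneg_right h1 (Real.rpow_nonneg hn0.le _)
    have h5 : 1440 * c = 1 := by rw [hc]; norm_num
    calc 1440 * ℓ ^ 2 * p ^ 2 = 1440 * (ℓ ^ 2 * p ^ 2) := by ring
      _ ≤ 1440 * (c * s) := mul_le_mul_of_nonneg_left h4 (by norm_num)
      _ = s := by rw [← mul_assoc, h5, one_mul]
  -- `f ≥ n/2` and hence `f ≥ 32 p^3`
  have hfn : (n : ℝ) / 2 ≤ f := by
    have h1 : ((n * (n - 1) : ℕ) : ℝ) ≤ n.factorial := by
      have : n * (n - 1) ≤ n.factorial := by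
        rw [← Nat.mul_factorial_pred (show n ≠ 0 by omega)]
        exact Nat.mul_le_mul_left n (Nat.self_le_factorial _)
      exact_mod_cast this
    have h2 : ((n * (n - 1) : ℕ) : ℝ) = (n : ℝ) * ((n : ℝ) - 1) := by
      push_cast [Nat.cast_sub (show 1 ≤ n by omega)]; ring
    have h3 : ((n : ℝ) / 2) ^ 2 ≤ n.factorial := by nlinarith only [h1, h2, h40]
    have := Real.abs_le_sqrt h3
    rwa [abs_of_nonneg (by positivity), ← hf] at this
  -- proof by contradiction: suppose `f < m p`
  by_contra hcon
  have hlt : f < m * p := by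
    refine not_le.mp fun h => hcon ?_
    calc m ^ 3 * p ^ 3 = (m * p) ^ 3 := by ring
      _ ≤ f ^ 3 := pow_le_pow_left₀ (by positivity) h 3
  have hf2 : f ^ 2 < m ^ 2 * p ^ 2 := by
    have := mul_self_lt_mul_self hf0.le hlt
    nlinarith only [this]
  have hf3 : f ^ 3 < m ^ 3 * p ^ 3 := by
    have h1 : f ^ 2 * f < f ^ 2 * (m * p) := mul_lt_mul_of_pos_left hlt (by positivity)
    have h2 : f ^ 2 * (m * p) ≤ m ^ 2 * p ^ 2 * (m * p) := mul_le_mul_of_nonneg_right hf2.le (by positivity)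
    nlinarith only [h1, h2]
  have hm32 : 32 * p ^ 2 < m := by
    have h1 : 32 * p ^ 3 ≤ f := by linarith only [hE1', hfn]
    have h2 : 32 * p ^ 2 * p < m * p := by
      calc 32 * p ^ 2 * p = 32 * p ^ 3 := by ring
        _ ≤ f := h1
        _ < m * p := hlt
    exact lt_of_mul_lt_mul_right h2 hp0.le
  have hmpos : 0 < m := lt_of_le_of_lt (by positivity) hm32
  -- the logarithm: `log(4 n n!/m²) ≤ 2 log n`
  have hL : Real.log (4 * n * n.factorial / m ^ 2) ≤ 2 * Real.log n := by
    have hm2 : 0 < m ^ 2 := by positivity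
    have h4p : 4 * p ^ 2 ≤ n := by
      have := mul_le_mul_of_nonneg_left hp1 (sq_nonneg p)
      nlinarith only [this, hE1']
    have hq : 4 * n * n.factorial / m ^ 2 ≤ (n : ℝ) ^ 2 := by
      rw [div_le_iff₀ hm2, hFf]
      calc 4 * (n : ℝ) * f ^ 2 ≤ 4 * n * (m ^ 2 * p ^ 2) :=
            mul_le_mul_of_nonneg_left hf2.le (by positivity)
        _ = n * m ^ 2 * (4 * p ^ 2) := by ring
        _ ≤ n * m ^ 2 * n := mul_le_mul_of_nonneg_left h4p (by positivity)
        _ = (n : ℝ) ^ 2 * m ^ 2 := by ring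
    calc Real.log (4 * n * n.factorial / m ^ 2) ≤ Real.log ((n : ℝ) ^ 2) :=
          Real.log_le_log (by rw [hFf]; positivity) hq
      _ = 2 * Real.log n := by rw [Real.log_pow]; push_cast; ring
  -- the pair term: `√(m² (1 + log n) log(4 n n!/m²)) ≤ 2 m ℓ²`
  have hGL : (1 + Real.log n) * Real.log (4 * n * n.factorial / m ^ 2) ≤ (2 * ℓ ^ 2) ^ 2 := by
    have hG : 1 + Real.log n ≤ 2 * ℓ ^ 2 := by rw [← hlogℓ]; linarith only [hlog1]
    have hL' : Real.log (4 * n * n.factorial / m ^ 2) ≤ 2 * ℓ ^ 2 := by rw [← hlogℓ]; exact hL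
    have hG0 : 0 ≤ 1 + Real.log n := by linarith only [hlog1]
    calc (1 + Real.log n) * Real.log (4 * n * n.factorial / m ^ 2) ≤ (1 + Real.log n) * (2 * ℓ ^ 2) :=
          mul_le_mul_of_nonneg_left hL' hG0
      _ ≤ (2 * ℓ ^ 2) * (2 * ℓ ^ 2) := mul_le_mul_of_nonneg_right hG (by positivity)
      _ = (2 * ℓ ^ 2) ^ 2 := by ring
  have hX : Real.sqrt (m ^ 2 * ((1 + Real.log n) * Real.log (4 * n * n.factorial / m ^ 2))) ≤ m * (2 * ℓ ^ 2) := by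
    calc Real.sqrt (m ^ 2 * ((1 + Real.log n) * Real.log (4 * n * n.factorial / m ^ 2)))
        ≤ Real.sqrt (m ^ 2 * (2 * ℓ ^ 2) ^ 2) := Real.sqrt_le_sqrt (mul_le_mul_of_nonneg_left hGL (sq_nonneg m))
      _ = m * (2 * ℓ ^ 2) := by
          rw [Real.sqrt_mul (sq_nonneg m), Real.sqrt_sq hm0, Real.sqrt_sq (by positivity)]
  -- the middle term: `n! √(n!)/√(n(n-1)/6) ≤ √12 f^3/n`
  have hG : (n.factorial : ℝ) * Real.sqrt (n.factorial : ℝ) / Real.sqrt (((n * (n - 1) : ℕ) : ℝ) / 6) ≤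
      Real.sqrt 12 * f ^ 3 / n := by
    have h2 : ((n * (n - 1) : ℕ) : ℝ) = (n : ℝ) * ((n : ℝ) - 1) := by
      push_cast [Nat.cast_sub (show 1 ≤ n by omega)]; ring
    have hd : (n : ℝ) / Real.sqrt 12 ≤ Real.sqrt (((n * (n - 1) : ℕ) : ℝ) / 6) := by
      rw [h2]
      have h12 : (0 : ℝ) < Real.sqrt 12 := by positivity
      rw [div_le_iff₀ h12]
      have h6 : (0 : ℝ) ≤ (n : ℝ) * ((n : ℝ) - 1) / 6 :=
        div_nonneg (mul_nonneg hn0.le (by linarith only [h40])) (by norm_num)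
      rw [← Real.sqrt_mul h6 12]
      refine (le_of_eq (Real.sqrt_sq hn0.le).symm).trans (Real.sqrt_le_sqrt ?_)
      nlinarith only [h40]
    have hnum : 0 ≤ (n.factorial : ℝ) * Real.sqrt (n.factorial : ℝ) := by positivity
    calc (n.factorial : ℝ) * Real.sqrt (n.factorial : ℝ) / Real.sqrt (((n * (n - 1) : ℕ) : ℝ) / 6)
        ≤ (n.factorial : ℝ) * Real.sqrt (n.factorial : ℝ) / ((n : ℝ) / Real.sqrt 12) :=
          div_le_div_of_nonneg_left hnum (by positivity) hd
      _ = Real.sqrt 12 * f ^ 3 / n := by rw [← hf, hFf]; field_simp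
  -- assemble: `m³/4 ≤ f² + √12 f³/n + 60 √2 f² m ℓ/s`
  rw [← hs] at hW
  have h20 : (0 : ℝ) ≤ 20 * (n.factorial : ℝ) / s := by positivity
  have hsumX := mul_le_mul_of_nonneg_left
    (add_le_add (add_le_add hX hX) hX) h20
  have hmain : m ^ 3 / 4 ≤ f ^ 2 + Real.sqrt 12 * f ^ 3 / n + 120 * f ^ 2 * m * ℓ ^ 2 / s := by
    have e : 20 * (n.factorial : ℝ) / s * (m * (2 * ℓ ^ 2) + m * (2 * ℓ ^ 2) + m * (2 * ℓ ^ 2)) =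
        120 * f ^ 2 * m * ℓ ^ 2 / s := by rw [hFf]; ring
    rw [e] at hsumX
    linarith only [hW, hG, hsumX, hFf]
  -- the three terms are each at most `m³/12`, the first strictly
  have hs12 : Real.sqrt 12 < 4 := by
    rw [show (4 : ℝ) = Real.sqrt 16 by rw [show (16 : ℝ) = 4 ^ 2 by norm_num, Real.sqrt_sq (by norm_num)]]
    exact Real.sqrt_lt_sqrt (by norm_num) (by norm_num)
  have hT1 : f ^ 2 < m ^ 3 / 12 := by
    have : m ^ 2 * p ^ 2 ≤ m ^ 2 * (m / 12) :=
      mul_le_mul_of_nonneg_left (by linarith only [hm32, hmpos]) (sq_nonneg m)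
    nlinarith only [this, hf2]
  have hT2 : Real.sqrt 12 * f ^ 3 / n ≤ m ^ 3 / 12 := by
    rw [div_le_iff₀ hn0]
    have h1 : Real.sqrt 12 * f ^ 3 ≤ Real.sqrt 12 * (m ^ 3 * p ^ 3) :=
      mul_le_mul_of_nonneg_left hf3.le (Real.sqrt_nonneg _)
    have h2 : Real.sqrt 12 * p ^ 3 ≤ n / 12 := by
      have := mul_le_mul_of_nonneg_right hs12.le (by positivity : (0 : ℝ) ≤ p ^ 3)
      linarith only [this, hE1']
    have h3 : Real.sqrt 12 * (m ^ 3 * p ^ 3) = m ^ 3 * (Real.sqrt 12 * p ^ 3) := by ring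
    have h4 : m ^ 3 * (Real.sqrt 12 * p ^ 3) ≤ m ^ 3 * (n / 12) := mul_le_mul_of_nonneg_left h2 (by positivity)
    nlinarith only [h1, h3, h4]
  have hT3 : 120 * f ^ 2 * m * ℓ ^ 2 / s ≤ m ^ 3 / 12 := by
    rw [div_le_iff₀ hs0]
    have h0 : 0 ≤ 120 * m * ℓ ^ 2 := by positivity
    have h1 : 120 * f ^ 2 * m * ℓ ^ 2 ≤ 120 * (m ^ 2 * p ^ 2) * m * ℓ ^ 2 := by
      calc 120 * f ^ 2 * m * ℓ ^ 2 = 120 * m * ℓ ^ 2 * f ^ 2 := by ring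
        _ ≤ 120 * m * ℓ ^ 2 * (m ^ 2 * p ^ 2) := mul_le_mul_of_nonneg_left hf2.le h0
        _ = 120 * (m ^ 2 * p ^ 2) * m * ℓ ^ 2 := by ring
    have h2 : 120 * (m ^ 2 * p ^ 2) * m * ℓ ^ 2 = m ^ 3 * (120 * ℓ ^ 2 * p ^ 2) := by ring
    have h3 : m ^ 3 * (120 * ℓ ^ 2 * p ^ 2) ≤ m ^ 3 * (s / 12) :=
      mul_le_mul_of_nonneg_left (by linarith only [hE2']) (by positivity)
    nlinarith only [h1, h2, h3]
  linarith only [hmain, hT1, hT2, hT3]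

end Summit.MatrixMultiplication.MatrixMultiplication.Theorems.PolynomialSlack
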